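import Literature.AlgebraicTopology.SingularHomology.TransverseDiscFunctional
import Literature.AlgebraicTopology.SingularHomology.LocalDegreeSign
import Mathlib.Topology.Compactification.OnePoint.Basic
import Mathlib.Analysis.Normed.Module.Ball.Homeomorph
import Mathlib.Topology.UrysohnsLemma
import HarnessLib

/-!
# The collapse map of a normal coordinate, and its effect on local homology

Topic `Literature/AlgebraicTopology/SingularHomology`.  A brick of the Pontryagin–Thom type for
the rigidity of natural de Rham comparisons
(`Literature.AlgebraicGeometry.HodgeTheory.NaturalDeRhamComparisonRigidity`, whose proof detects
the homology of a handlebody by smooth maps to spheres dual to the right-hand discs).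

Given a *normal coordinate* to a closed stratum `P` of a normal space `X` — an open
neighbourhood `N ⊇ P` and a continuous `K : N → ℝᵏ` with `K⁻¹(0) = P`, the data of the tree's
`Literature.AlgebraicTopology.SingularHomology.TransverseDiscDatum` (Milnor, *Lectures on the
h-cobordism theorem* (1965), proof of Lemma 6.3: the normal coordinate of the Thom class) — we
construct the **collapse** `g : X → ℝᵏ ∪ {∞} = Sᵏ` (Thom 1954, Ch. II; Milnor–Stasheff §18,
Pontryagin–Thom construction): `g = ∞` off `N`, `g z = K z / ρ z` read in the one-point
compactification through the unit ball, with `ρ` a Urysohn function, `ρ = 1` near `P`,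
supported in `N` (`TransverseDiscDatum.exists_collapse`).  It is continuous on all of `X`,
`g⁻¹(0) = P` exactly, and `g = β ∘ K` near `P`, where `β : ℝᵏ → ℝᵏ ∪ {∞}` is the collapse of
the unit ball (`ballCollapse`: the inverse of Mathlib's `Homeomorph.unitBall` on the open unit
ball, `∞` outside).

Main result (`TransverseDiscDatum.isIso_localHomology_map_collapse`): if the transverse disc
`m : B̄(0, r) → X` of the datum satisfies `K ∘ m = id` and lies in `N`, then for every subset
`L ⊇ m(B̄(0, r))` of which the disc is a neighbourhood of the centre `p = m 0` *within `L`*, and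
which meets `P` only at `p`, the collapse induces an **isomorphism on local homology
`Hₙ(L | p) ≅ Hₙ(ℝᵏ ∪ {∞} | 0)`** in every degree and for all coefficients: near the centre the
composite `B(0, δ) → L → ℝᵏ ∪ {∞}` is the open embedding `β`, and local homology is local
(excision, Hatcher 2002, Thm. 2.20 / §3.3 p. 231).  In the application `L` is a left-hand disc
`D_L(p)` of a Morse function, `P` a right-hand disc `D_R(p)`, and the isomorphism says that the
class of `D_L(p)` is detected by the collapse of the normal coordinate of `D_R(p)`.

Everything here is proved; the only definitions are the explicit maps.  Spaces mapping to
`ℝᵏ ∪ {∞} : Type` are taken in `Type` (maps of pairs in the tree's relative homology live in one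
universe).

## References

* R. Thom, *Quelques propriétés globales des variétés différentiables*, Comment. Math. Helv. 28
  (1954), Ch. II (the collapse onto the Thom space). [ThomCMH1954]
* J. Milnor, *Lectures on the h-cobordism theorem*, Princeton Math. Notes (1965), proof of
  Lemma 6.3 (PDF p. 37). [MilnorHCobordism1965]
* A. Hatcher, *Algebraic Topology*, CUP 2002, Thm. 2.20, §3.3 p. 231. [HatcherAT2002]
-/

noncomputable section

open Set Function Filter Metric Topology CategoryTheory OnePoint

universe u v

namespace Literature.AlgebraicTopology.SingularHomology

/-! ### The collapse of the unit ball of a normed space onto the one-point compactification -/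

section BallCollapse

variable {E : Type*} [NormedAddCommGroup E] [NormedSpace ℝ E]

/-- The **collapse of the unit ball**: `v ↦ unitBall⁻¹ v ∈ E ⊆ E ∪ {∞}` on the open unit ball,
`∞` outside it (the model of the Pontryagin–Thom collapse, `Dᵏ/∂Dᵏ = ℝᵏ ∪ {∞}`). [folklore] -/
def ballCollapseFun (v : E) : OnePoint E := by
  classical
  exact if h : v ∈ ball (0 : E) 1 then ↑(Homeomorph.unitBall.symm ⟨v, h⟩) else ∞

/-- On the open unit ball the collapse is `unitBall⁻¹`. [folklore] -/
theorem ballCollapseFun_of_mem {v : E} (h : v ∈ ball (0 : E) 1) :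
    ballCollapseFun v = ↑(Homeomorph.unitBall.symm ⟨v, h⟩) := by
  classical
  simp only [ballCollapseFun, dif_pos h]

/-- Off the open unit ball the collapse is `∞`. [folklore] -/
theorem ballCollapseFun_of_not_mem {v : E} (h : v ∉ ball (0 : E) 1) : ballCollapseFun v = ∞ := by
  classical
  simp only [ballCollapseFun, dif_neg h]

/-- The collapse restricted to the open unit ball is `(↑) ∘ unitBall⁻¹`. [folklore] -/
theorem ballCollapseFun_comp_subtypeVal :
    (ballCollapseFun ∘ ((↑) : ↥(ball (0 : E) 1) → E)) = (↑) ∘ Homeomorph.unitBall.symm := by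
  funext b
  simp only [comp_apply, ballCollapseFun_of_mem b.2, Subtype.coe_eta]

/-- The collapse restricted to the open unit ball is an open embedding. [folklore] -/
theorem isOpenEmbedding_ballCollapseFun_comp_subtypeVal :
    IsOpenEmbedding (ballCollapseFun ∘ ((↑) : ↥(ball (0 : E) 1) → E)) := by
  rw [ballCollapseFun_comp_subtypeVal]
  exact isOpenEmbedding_coe.comp (Homeomorph.unitBall (E := E)).symm.isOpenEmbedding

omit [NormedSpace ℝ E] in
/-- At a point off the open unit ball, the inclusion of the ball tends to the cocompact filter
(the ball is open, so its compact subsets are closed in `E` and miss the point). [folklore] -/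
theorem comap_subtypeVal_nhds_le_cocompact {v : E} (hv : v ∉ ball (0 : E) 1) :
    comap ((↑) : ↥(ball (0 : E) 1) → E) (𝓝 v) ≤ cocompact ↥(ball (0 : E) 1) := by
  refine hasBasis_cocompact.ge_iff.2 fun K hK => ?_
  refine ⟨(((↑) : ↥(ball (0 : E) 1) → E) '' K)ᶜ, ?_, ?_⟩
  · refine (hK.image continuous_subtype_val).isClosed.isOpen_compl.mem_nhds ?_
    rintro ⟨b, -, rfl⟩
    exact hv b.2
  · intro b hb hbK
    exact hb (mem_image_of_mem _ hbK)

/-- **The collapse of the unit ball is continuous.** [folklore] -/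
theorem continuous_ballCollapseFun : Continuous (ballCollapseFun : E → OnePoint E) := by
  refine continuous_iff_continuousAt.2 fun v => ?_
  by_cases hv : v ∈ ball (0 : E) 1
  · have hnhds : ball (0 : E) 1 ∈ 𝓝 v := isOpen_ball.mem_nhds hv
    have key : ContinuousOn (ballCollapseFun : E → OnePoint E) (ball (0 : E) 1) := by
      rw [continuousOn_iff_continuous_restrict]
      have : (ball (0 : E) 1).restrict (ballCollapseFun : E → OnePoint E) =
          ballCollapseFun ∘ ((↑) : ↥(ball (0 : E) 1) → E) := rfl
      rw [this, ballCollapseFun_comp_subtypeVal]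
      exact continuous_coe.comp (Homeomorph.unitBall (E := E)).symm.continuous
    exact key.continuousAt hnhds
  · -- off the open ball: `∞`, and the nearby values on the ball leave every compact
    rw [ContinuousAt, ballCollapseFun_of_not_mem hv]
    have huniv : (ball (0 : E) 1) ∪ (ball (0 : E) 1)ᶜ = univ := union_compl_self _
    rw [← nhdsWithin_univ, ← huniv, nhdsWithin_union]
    refine Tendsto.sup ?_ ?_
    · -- on the ball
      have hle : 𝓝[ball (0 : E) 1] v ≤ map ((↑) : ↥(ball (0 : E) 1) → E)
          (comap ((↑) : ↥(ball (0 : E) 1) → E) (𝓝 v)) := by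
        rw [Filter.map_comap, Subtype.range_coe_subtype, setOf_mem_eq]
        exact le_rfl
      refine Tendsto.mono_left ?_ hle
      rw [tendsto_map'_iff, ballCollapseFun_comp_subtypeVal]
      refine tendsto_coe_infty.comp ?_
      refine Tendsto.mono_right ?_ cocompact_le_coclosedCompact
      have h2 : Tendsto (Homeomorph.unitBall (E := E)).symm (cocompact ↥(ball (0 : E) 1))
          (cocompact E) := by
        rw [← (Homeomorph.unitBall (E := E)).symm.map_cocompact]
        exact tendsto_map
      exact h2.mono_left (comap_subtypeVal_nhds_le_cocompact hv)
    · -- off the ball: constant `∞`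
      refine (tendsto_const_nhds (x := (∞ : OnePoint E))).congr' ?_
      filter_upwards [self_mem_nhdsWithin] with w hw
      exact (ballCollapseFun_of_not_mem hw).symm

/-- The collapse of the unit ball, as a continuous map. [folklore] -/
def ballCollapse : C(E, OnePoint E) := ⟨ballCollapseFun, continuous_ballCollapseFun⟩

/-- Unfolding `ballCollapse`. [folklore] -/
@[simp] theorem ballCollapse_apply (v : E) : ballCollapse v = ballCollapseFun v := rfl

/-- The collapse takes the value `↑0` exactly at the origin. [folklore] -/
theorem ballCollapseFun_eq_coe_zero_iff {v : E} : ballCollapseFun v = ↑(0 : E) ↔ v = 0 := by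
  by_cases hv : v ∈ ball (0 : E) 1
  · rw [ballCollapseFun_of_mem hv, coe_eq_coe]
    constructor
    · intro h
      have h1 := congrArg (Homeomorph.unitBall (E := E)) h
      rw [Homeomorph.apply_symm_apply] at h1
      have h2 := congrArg Subtype.val h1
      rwa [Homeomorph.coe_unitBall_apply_zero] at h2
    · intro h
      subst h
      have h1 : (⟨0, hv⟩ : ↥(ball (0 : E) 1)) = Homeomorph.unitBall (0 : E) :=
        Subtype.ext (Homeomorph.coe_unitBall_apply_zero).symm
      rw [h1, Homeomorph.symm_apply_apply]
  · rw [ballCollapseFun_of_not_mem hv]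
    constructor
    · intro h; exact (infty_ne_coe _ h).elim
    · intro h; exact (hv (h ▸ mem_ball_self one_pos)).elim

/-- A vector of norm `≥ 1` is collapsed to `∞`. [folklore] -/
theorem ballCollapseFun_of_one_le_norm {v : E} (h : 1 ≤ ‖v‖) : ballCollapseFun v = ∞ :=
  ballCollapseFun_of_not_mem fun hv => (mem_ball_zero_iff.1 hv).not_ge h

end BallCollapse

/-! ### The collapse of a normal coordinate -/

namespace TransverseDiscDatum

variable {k : ℕ} {X : Type} [TopologicalSpace X]

/-- **Urysohn data for a normal coordinate**: on a normal space, an open `V` with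
`P ⊆ V ⊆ N`, an open `N₁` with `closure V ⊆ N₁`, `closure N₁ ⊆ N`, and a continuous
`ρ : X → [0, 1]` with `ρ = 1` on `V` and `ρ = 0` off `N₁`. [folklore] -/
theorem exists_urysohn [NormalSpace X] (D : TransverseDiscDatum X k) :
    ∃ (V N₁ : Set X) (ρ : C(X, ℝ)), IsOpen V ∧ D.P ⊆ V ∧ V ⊆ N₁ ∧ IsOpen N₁ ∧ closure N₁ ⊆ D.N ∧
      EqOn ρ 1 V ∧ EqOn ρ 0 N₁ᶜ ∧ ∀ x, ρ x ∈ Icc (0 : ℝ) 1 := by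
  obtain ⟨N₁, hN₁, hPN₁, hclN₁⟩ := normal_exists_closure_subset D.isClosed_P D.isOpen_N D.subset
  obtain ⟨V, hV, hPV, hclV⟩ := normal_exists_closure_subset D.isClosed_P hN₁ hPN₁
  obtain ⟨ρ, hρ0, hρ1, hρ⟩ := exists_continuous_zero_one_of_isClosed hN₁.isClosed_compl
    isClosed_closure (disjoint_compl_left_iff.2 hclV)
  exact ⟨V, N₁, ρ, hV, hPV, subset_closure.trans hclV, hN₁, hclN₁,
    fun x hx => hρ1 (subset_closure hx), hρ0, hρ⟩

/-- The collapse map of the normal coordinate, given Urysohn data `ρ` (as a bare function):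
`z ↦ β (K z / ρ z)` where this makes sense (`z ∈ N`, `ρ z > 0`), `∞` elsewhere. [cite: MilnorHCobordism1965, proof of Lemma 6.3 (PDF p. 37)] -/
def collapseFun (D : TransverseDiscDatum X k) (ρ : C(X, ℝ)) (z : X) :
    OnePoint (EuclideanSpace ℝ (Fin k)) := by
  classical
  exact if h : z ∈ D.N ∧ 0 < ρ z then ballCollapseFun ((ρ z)⁻¹ • D.K ⟨z, h.1⟩) else ∞

/-- The value of the collapse at a point of `N` with `ρ > 0`. [folklore] -/
theorem collapseFun_of_pos (D : TransverseDiscDatum X k) (ρ : C(X, ℝ)) (z : ↥D.N) (hz : 0 < ρ z) :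
    D.collapseFun ρ z = ballCollapseFun ((ρ z)⁻¹ • D.K z) := by
  classical
  have h : (z : X) ∈ D.N ∧ 0 < ρ z := ⟨z.2, hz⟩
  simp only [collapseFun, dif_pos h, Subtype.coe_eta]

/-- The value of the collapse where `ρ ≤ 0`. [folklore] -/
theorem collapseFun_of_nonpos (D : TransverseDiscDatum X k) (ρ : C(X, ℝ)) {z : X} (hz : ρ z ≤ 0) :
    D.collapseFun ρ z = ∞ := by
  classical
  simp only [collapseFun, dif_neg (fun h : z ∈ D.N ∧ 0 < ρ z => hz.not_gt h.2)]

/-- The value of the collapse off `N`. [folklore] -/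
theorem collapseFun_of_not_mem (D : TransverseDiscDatum X k) (ρ : C(X, ℝ)) {z : X} (hz : z ∉ D.N) :
    D.collapseFun ρ z = ∞ := by
  classical
  simp only [collapseFun, dif_neg (fun h : z ∈ D.N ∧ 0 < ρ z => hz h.1)]

/-- **Continuity of the collapse of a normal coordinate.**  With Urysohn data as in
`exists_urysohn` (`ρ = 1` on an open `V ⊇ P`, `ρ = 0` off an open `N₁` with `closure N₁ ⊆ N`):
on `{z ∈ N | ρ z > 0}` the map is a composite of continuous maps; at a point `z ∈ N` with
`ρ z = 0` one has `K z ≠ 0`, so `‖K w‖ > ρ w` nearby and the collapse is `∞` there; off `N` the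
function `ρ` vanishes near the point. [cite: MilnorHCobordism1965, proof of Lemma 6.3 (PDF p. 37)] -/
theorem continuous_collapseFun (D : TransverseDiscDatum X k) {V N₁ : Set X} (ρ : C(X, ℝ))
    (hPV : D.P ⊆ V) (hclN₁ : closure N₁ ⊆ D.N)
    (hρ1 : EqOn ρ 1 V) (hρ0 : EqOn ρ 0 N₁ᶜ) :
    Continuous (D.collapseFun ρ) := by
  classical
  refine continuous_iff_continuousAt.2 fun z => ?_
  by_cases h : z ∈ D.N ∧ 0 < ρ z
  · -- on the open set `W = {z ∈ N | ρ z > 0}`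
    set W : Set X := D.N ∩ ρ ⁻¹' Ioi 0 with hW
    have hWo : IsOpen W := D.isOpen_N.inter (isOpen_Ioi.preimage ρ.continuous)
    have hzW : z ∈ W := h
    have hWN : W ⊆ D.N := inter_subset_left
    have hcont : ContinuousOn (D.collapseFun ρ) W := by
      rw [continuousOn_iff_continuous_restrict]
      have heq : W.restrict (D.collapseFun ρ) = fun w : ↥W =>
          ballCollapseFun ((ρ w)⁻¹ • D.K ⟨w, hWN w.2⟩) := by
        funext w
        exact D.collapseFun_of_pos ρ ⟨w, hWN w.2⟩ w.2.2
      rw [heq]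
      refine continuous_ballCollapseFun.comp ?_
      have h1 : Continuous fun w : ↥W => (ρ w)⁻¹ :=
        (ρ.continuous.comp continuous_subtype_val).inv₀ fun w => w.2.2.ne'
      exact h1.smul (D.K.continuous.comp (continuous_inclusion hWN))
    exact hcont.continuousAt (hWo.mem_nhds hzW)
  · -- the value is `∞`, and the map is `∞` near `z`
    have hz : D.collapseFun ρ z = ∞ := by simp only [collapseFun, dif_neg h]
    rw [ContinuousAt, hz]
    refine (tendsto_const_nhds (x := (∞ : OnePoint (EuclideanSpace ℝ (Fin k))))).congr' ?_
    by_cases hzN : z ∈ D.N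
    · -- `z ∈ N`, `ρ z = 0`, hence `z ∉ P` and `K z ≠ 0`
      have hρz : ρ z ≤ 0 := not_lt.1 fun h' => h ⟨hzN, h'⟩
      have hzP : z ∉ D.P := fun hzP => by
        have := hρ1 (hPV hzP)
        simp only [Pi.one_apply] at this
        linarith
      have hKz : D.K ⟨z, hzN⟩ ≠ 0 := fun h0 => hzP ((D.eq_zero_iff ⟨z, hzN⟩).1 h0)
      have hKpos : 0 < ‖D.K ⟨z, hzN⟩‖ := norm_pos_iff.2 hKz
      -- the open set `{w ∈ N | ρ w < ‖K w‖}`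
      set O : Set ↥D.N := {w | ρ w < ‖D.K w‖} with hO
      have hOo : IsOpen O :=
        isOpen_lt (ρ.continuous.comp continuous_subtype_val) (continuous_norm.comp D.K.continuous)
      have hzO : (⟨z, hzN⟩ : ↥D.N) ∈ O := hρz.trans_lt hKpos
      have hOX : IsOpen (((↑) : ↥D.N → X) '' O) := D.isOpen_N.isOpenMap_subtype_val O hOo
      have hzOX : z ∈ ((↑) : ↥D.N → X) '' O := ⟨⟨z, hzN⟩, hzO, rfl⟩
      filter_upwards [hOX.mem_nhds hzOX]
      rintro _ ⟨w, hw, rfl⟩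
      by_cases hρw : 0 < ρ w
      · rw [D.collapseFun_of_pos ρ w hρw, ballCollapseFun_of_one_le_norm]
        rw [norm_smul, norm_inv, Real.norm_eq_abs, abs_of_pos hρw]
        rw [le_inv_mul_iff₀ hρw, mul_one]
        exact le_of_lt hw
      · exact (D.collapseFun_of_nonpos ρ (not_lt.1 hρw)).symm
    · -- `z ∉ N`: `ρ = 0` near `z`
      have hzcl : z ∉ closure N₁ := fun hz' => hzN (hclN₁ hz')
      filter_upwards [isClosed_closure.isOpen_compl.mem_nhds hzcl] with w hw
      have hw' : w ∈ N₁ᶜ := fun hwN => hw (subset_closure hwN)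
      have hρw : ρ w = 0 := hρ0 hw'
      exact (D.collapseFun_of_nonpos ρ hρw.le).symm

/-- **The collapse of a normal coordinate** (existence form).  On a normal space, a transverse
disc datum `(P, N, K, …)` admits a continuous collapse `g : X → ℝᵏ ∪ {∞}` which equals
`β ∘ K` (`β` the collapse of the unit ball) on an open `V` with `P ⊆ V ⊆ N`, and takes the
value `↑0` exactly on `P`. [cite: ThomCMH1954, Ch. II] [cite: MilnorHCobordism1965, proof of Lemma 6.3 (PDF p. 37)] -/
theorem exists_collapse [NormalSpace X] (D : TransverseDiscDatum X k) :
    ∃ (g : C(X, OnePoint (EuclideanSpace ℝ (Fin k)))) (V : Set X), IsOpen V ∧ D.P ⊆ V ∧ V ⊆ D.N ∧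
      (∀ z : ↥D.N, (z : X) ∈ V → g z = ballCollapseFun (D.K z)) ∧
      (∀ z : X, g z = ↑(0 : EuclideanSpace ℝ (Fin k)) ↔ z ∈ D.P) := by
  obtain ⟨V, N₁, ρ, hV, hPV, hVN₁, hN₁, hclN₁, hρ1, hρ0, hρ⟩ := D.exists_urysohn
  have hVN : V ⊆ D.N := hVN₁.trans (subset_closure.trans hclN₁)
  refine ⟨⟨D.collapseFun ρ, D.continuous_collapseFun ρ hPV hclN₁ hρ1 hρ0⟩, V, hV, hPV, hVN,
    fun z hz => ?_, fun z => ?_⟩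
  · have h1 : ρ z = 1 := hρ1 hz
    change D.collapseFun ρ z = _
    rw [D.collapseFun_of_pos ρ z (by rw [h1]; exact one_pos), h1, inv_one, one_smul]
  · change D.collapseFun ρ z = _ ↔ _
    constructor
    · intro hz
      by_cases h : z ∈ D.N ∧ 0 < ρ z
      · rw [D.collapseFun_of_pos ρ ⟨z, h.1⟩ h.2, ballCollapseFun_eq_coe_zero_iff, smul_eq_zero,
          inv_eq_zero] at hz
        rcases hz with hz | hz
        · exact absurd hz h.2.ne'
        · exact (D.eq_zero_iff ⟨z, h.1⟩).1 hz
      · have : D.collapseFun ρ z = ∞ := by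
          classical
          simp only [collapseFun, dif_neg h]
        rw [this] at hz
        exact absurd hz (infty_ne_coe _)
    · intro hz
      have hzV : z ∈ V := hPV hz
      have h1 : ρ z = 1 := hρ1 hzV
      rw [D.collapseFun_of_pos ρ ⟨z, hVN hzV⟩ (by rw [h1]; exact one_pos), h1, inv_one, one_smul,
        ballCollapseFun_eq_coe_zero_iff]
      exact (D.eq_zero_iff ⟨z, hVN hzV⟩).2 hz

end TransverseDiscDatum

/-! ### Local homology of a subspace at a point: only a neighbourhood within the subspace matters -/

section WithinSubspace

variable (R : Type v) [CommRing R] (M : Type v) [AddCommGroup M] [Module R M]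
variable {X : Type u} [TopologicalSpace X]

/-- **An inclusion `S ⊆ T` with `S` a neighbourhood of `c` *within `T`* induces
`Hₙ(S | c; M) ≅ Hₙ(T | c; M)`**, any coefficients (excision in the space `T`, Hatcher 2002,
Thm. 2.20, read through the tautological homeomorphism `{x : T // ↑x ∈ S} ≅ S`; the tree's
`localHomology.isIso_map_subsetInclusion_of_mem_nhdsWithin` is the case `ℤ`). [cite: HatcherAT2002, Thm. 2.20, §3.3 p. 231] -/
theorem localHomology.isIso_map_subsetInclusion_of_mem_nhdsWithin_coeff [T1Space X] {S T : Set X}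
    (hST : S ⊆ T) {c : X} (hcS : c ∈ S) (hS : S ∈ 𝓝[T] c) (n : ℕ)
    (h : MapsTo (subsetInclusion hST) {(⟨c, hcS⟩ : ↥S)}ᶜ {(⟨c, hST hcS⟩ : ↥T)}ᶜ) :
    IsIso (relativeSingularHomology.map R M (subsetInclusion hST) h n) := by
  -- the trace `S'` of `S` on `T` is a neighbourhood of `c` in `T`
  set S' : Set ↥T := Subtype.val ⁻¹' S with hS'
  have hcT : c ∈ T := hST hcS
  have hcS' : (⟨c, hcT⟩ : ↥T) ∈ S' := hcS
  have hint : (⟨c, hcT⟩ : ↥T) ∈ interior S' := by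
    rw [mem_interior_iff_mem_nhds]
    exact (preimage_coe_mem_nhds_subtype (s := T) (a := ⟨c, hcT⟩)).2 hS
  haveI hiso := localHomology.isIso_map_subsetIncl_of_mem_interior R M hint n
  -- the homeomorphism `S' ≅ S` as a map of pairs
  let e : ↥S' ≃ₜ ↥S := preimageValHomeomorphOfSubset hST
  have he : MapsTo (e : C(↥S', ↥S)) ({(⟨⟨c, hcT⟩, hcS'⟩ : ↥S')}ᶜ : Set ↥S') ({(⟨c, hcS⟩ : ↥S)}ᶜ) := by
    intro x hx hx'
    apply hx
    rw [mem_singleton_iff] at hx' ⊢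
    exact e.injective hx'
  have he' : MapsTo (e.symm : C(↥S, ↥S')) ({(⟨c, hcS⟩ : ↥S)}ᶜ : Set ↥S) ({(⟨⟨c, hcT⟩, hcS'⟩ : ↥S')}ᶜ) := by
    intro y hy hy'
    apply hy
    rw [mem_singleton_iff] at hy' ⊢
    exact e.symm.injective hy'
  haveI := relativeSingularHomology.isIso_map_homeomorph R M e he he' n
  -- `subsetIncl S' = subsetInclusion hST ∘ e`
  have hfac : relativeSingularHomology.map R M (subsetIncl S')
        (localHomology.mapsTo_subsetIncl_compl (interior_subset hint)) n =
      relativeSingularHomology.map R M (e : C(↥S', ↥S)) he n ≫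
        relativeSingularHomology.map R M (subsetInclusion hST) h n := by
    rw [← relativeSingularHomology.map_comp]
    rfl
  exact IsIso.of_isIso_fac_left hfac.symm

end WithinSubspace

/-! ### The collapse detects the transverse disc: an isomorphism on local homology -/

namespace TransverseDiscDatum

variable (R : Type v) [CommRing R] (M : Type v) [AddCommGroup M] [Module R M]
variable {k : ℕ} {X : Type} [TopologicalSpace X]

omit [TopologicalSpace X] in
/-- A map taking the value `y₀` exactly on `P` is a map of pairs `(L, L ∖ p) → (Y, Y ∖ y₀)` on
every `L` meeting `P` only at `p`. [folklore] -/
theorem mapsTo_compl_of_apply_eq_iff {Y : Type} {g : X → Y} {P : Set X} {y₀ : Y}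
    (hg : ∀ z, g z = y₀ ↔ z ∈ P) {L : Set X} {p : ↥L} (hLP : ∀ z : ↥L, (z : X) ∈ P → z = p) :
    MapsTo (g ∘ ((↑) : ↥L → X)) ({p}ᶜ : Set ↥L) ({y₀}ᶜ : Set Y) :=
  fun z hz hgz => hz (hLP z ((hg z).1 hgz))

/-- **The collapse of a normal coordinate is an isomorphism on local homology along the
transverse disc.**  Let `D = (P, N, K, m, r)` be a transverse disc datum whose disc lies in `N`
with `K ∘ m = id` on `B̄(0, r)`, `g` a collapse of it (`g = β ∘ K` on an open `V`,
`P ⊆ V ⊆ N`, `g⁻¹(↑0) = P`), and `L ⊇ m(B̄(0, r))` a subset of which the disc is a neighbourhood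
of the centre `p = m 0` within `L` and which meets `P` only at `p`.  Then
`g⁎ : Hₙ(L | p) → Hₙ(ℝᵏ ∪ {∞} | ↑0)` is an isomorphism: on a small ball `B(0, δ)` the composite
`B(0, δ) → L → ℝᵏ ∪ {∞}`, `v ↦ g (m v) = β v`, is an open embedding (an isomorphism on local
homology, Hatcher §3.3 p. 231), and `B(0, δ) → B̄(0, δ) ≅ m(B̄(0, δ)) → L` is one as well
(excision, twice). [cite: HatcherAT2002, Thm. 2.20, §3.3 p. 231] [cite: MilnorHCobordism1965, proof of Lemma 6.3 (PDF p. 37)] -/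
theorem isIso_localHomology_map_collapse [T2Space X] (D : TransverseDiscDatum X k)
    (g : C(X, OnePoint (EuclideanSpace ℝ (Fin k)))) {V : Set X} (hV : IsOpen V) (hPV : D.P ⊆ V)
    (hgV : ∀ z : ↥D.N, (z : X) ∈ V → g z = ballCollapseFun (D.K z))
    (hgP : ∀ z : X, g z = ↑(0 : EuclideanSpace ℝ (Fin k)) ↔ z ∈ D.P)
    (hmN : MapsTo D.m (closedBall 0 D.r) D.N)
    (hKm : ∀ (v : EuclideanSpace ℝ (Fin k)) (hv : v ∈ closedBall 0 D.r), D.K ⟨D.m v, hmN hv⟩ = v)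
    {L : Set X} (hDL : D.disc ⊆ L) (hnhds : (D.disc : Set X) ∈ 𝓝[L] (D.m 0))
    (hLP : ∀ z : ↥L, (z : X) ∈ D.P → z = ⟨D.m 0, hDL D.centre.2⟩) (n : ℕ) :
    IsIso (relativeSingularHomology.map R M (g.comp (subsetIncl L))
      (mapsTo_compl_of_apply_eq_iff hgP hLP) n) := by
  have hr := D.r_pos
  -- the centre lies on `P`
  have hm0N : D.m 0 ∈ D.N := hmN (mem_closedBall_self hr.le)
  have hm0P : D.m 0 ∈ D.P := (D.eq_zero_iff ⟨D.m 0, hm0N⟩).1 (hKm 0 (mem_closedBall_self hr.le))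
  -- a small radius `δ`: `δ ≤ r`, `δ ≤ 1`, and `m (B̄(0, δ)) ⊆ V`
  obtain ⟨δ, hδ, hδr, hδ1, hδV⟩ : ∃ δ : ℝ, 0 < δ ∧ δ ≤ D.r ∧ δ ≤ 1 ∧
      ∀ v ∈ closedBall (0 : EuclideanSpace ℝ (Fin k)) δ, D.m v ∈ V := by
    have hc : ContinuousWithinAt D.m (closedBall 0 D.r) 0 :=
      D.continuousOn_m 0 (mem_closedBall_self hr.le)
    have hVm : D.m ⁻¹' V ∈ 𝓝[closedBall 0 D.r] (0 : EuclideanSpace ℝ (Fin k)) :=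
      hc (hV.mem_nhds (hPV hm0P))
    obtain ⟨ε, hε, hεV⟩ := Metric.mem_nhdsWithin_iff.1 hVm
    refine ⟨min (ε / 2) (min D.r 1), lt_min (half_pos hε) (lt_min hr one_pos),
      (min_le_right _ _).trans (min_le_left _ _), (min_le_right _ _).trans (min_le_right _ _),
      fun v hv => ?_⟩
    have hv' := mem_closedBall_zero_iff.1 hv
    refine hεV ⟨mem_ball_zero_iff.2 ?_, mem_closedBall_zero_iff.2 ?_⟩
    · exact hv'.trans_lt ((min_le_left _ _).trans_lt (half_lt_self hε))
    · exact hv'.trans ((min_le_right _ _).trans (min_le_left _ _))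
  -- notation
  set Bδ : Set (EuclideanSpace ℝ (Fin k)) := ball 0 δ with hBδ
  set Cδ : Set (EuclideanSpace ℝ (Fin k)) := closedBall 0 δ with hCδ
  have hBC : Bδ ⊆ Cδ := ball_subset_closedBall
  have hCr : Cδ ⊆ closedBall 0 D.r := closedBall_subset_closedBall hδr
  set Fδ : Set X := D.m '' Cδ with hFδ
  have hFdisc : Fδ ⊆ D.disc := image_mono hCr
  have hFL : Fδ ⊆ L := hFdisc.trans hDL
  have h0B : (0 : EuclideanSpace ℝ (Fin k)) ∈ Bδ := mem_ball_self hδ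
  have h0C : (0 : EuclideanSpace ℝ (Fin k)) ∈ Cδ := mem_closedBall_self hδ.le
  have hm0F : D.m 0 ∈ Fδ := mem_image_of_mem _ h0C
  -- the homeomorphism `B̄(0, δ) ≅ Fδ`
  have hmc : ContinuousOn D.m Cδ := D.continuousOn_m.mono hCr
  have hmi : InjOn D.m Cδ := D.injOn_m.mono hCr
  obtain ⟨e, he⟩ := exists_homeomorph_image_closedBall D.m hmc hmi
  have he0 : e ⟨0, h0C⟩ = ⟨D.m 0, hm0F⟩ := Subtype.ext (he _)
  -- the points
  set pL : ↥L := ⟨D.m 0, hDL D.centre.2⟩ with hpL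
  set pF : ↥Fδ := ⟨D.m 0, hm0F⟩ with hpF
  set c0 : ↥Cδ := ⟨0, h0C⟩ with hc0
  set b0 : ↥Bδ := ⟨0, h0B⟩ with hb0
  -- (1) `B(0, δ) ⊆ B̄(0, δ)` is an isomorphism on local homology at `0`
  have hι₁ : MapsTo (subsetInclusion hBC) ({b0}ᶜ : Set ↥Bδ) ({c0}ᶜ : Set ↥Cδ) := by
    intro v hv h
    apply hv
    rw [mem_singleton_iff] at h ⊢
    exact Subtype.ext (congrArg Subtype.val h :)
  haveI iso₁ : IsIso (relativeSingularHomology.map R M (subsetInclusion hBC) hι₁ n) :=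
    localHomology.isIso_map_subsetInclusion_of_mem_interior R M hBC
      (by rw [hBδ, interior_eq_iff_isOpen.2 isOpen_ball]; exact h0B) n hι₁
  -- (2) the homeomorphism `B̄(0, δ) ≅ Fδ`
  have hι₂ : MapsTo (e : C(↥Cδ, ↥Fδ)) ({c0}ᶜ : Set ↥Cδ) ({pF}ᶜ : Set ↥Fδ) := by
    intro v hv h
    apply hv
    rw [mem_singleton_iff] at h ⊢
    have h' : e v = pF := h
    apply e.injective
    rw [h', he0]
  have hι₂' : MapsTo (e.symm : C(↥Fδ, ↥Cδ)) ({pF}ᶜ : Set ↥Fδ) ({c0}ᶜ : Set ↥Cδ) := by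
    intro y hy h
    apply hy
    rw [mem_singleton_iff] at h ⊢
    have h' : e.symm y = c0 := h
    rw [← e.apply_symm_apply y, h', he0]
  haveI iso₂ : IsIso (relativeSingularHomology.map R M (e : C(↥Cδ, ↥Fδ)) hι₂ n) :=
    relativeSingularHomology.isIso_map_homeomorph R M e hι₂ hι₂' n
  -- (3) `Fδ ⊆ L` is a neighbourhood of `p` within `L`
  have hFnhds : Fδ ∈ 𝓝[L] (D.m 0) := by
    -- `m (B(0, δ))` is open in the disc, and the disc is a neighbourhood within `L`
    obtain ⟨e', he'⟩ := exists_homeomorph_image_closedBall D.m D.continuousOn_m D.injOn_m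
    have hopen : IsOpen (e' '' (Subtype.val ⁻¹' Bδ)) :=
      e'.isOpenMap _ (isOpen_ball.preimage continuous_subtype_val)
    obtain ⟨W, hW, hWeq⟩ := isOpen_induced_iff.1 hopen
    -- `W ∩ disc = m (B(0, δ))` as subsets of `X`
    have hWdisc : W ∩ D.disc ⊆ Fδ := by
      rintro z ⟨hzW, hzd⟩
      have hz : (⟨z, hzd⟩ : ↥D.disc) ∈ Subtype.val ⁻¹' W := hzW
      rw [hWeq] at hz
      obtain ⟨v, hv, hvz⟩ := hz
      have hvz' : D.m v = z := by rw [← he' v, hvz]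
      exact ⟨v, hBC hv, hvz'⟩
    have hm0W : D.m 0 ∈ W := by
      have : e' ⟨0, mem_closedBall_self hr.le⟩ ∈ e' '' (Subtype.val ⁻¹' Bδ) :=
        mem_image_of_mem _ h0B
      rw [← hWeq] at this
      simpa only [mem_preimage, he'] using this
    have h1 : W ∩ D.disc ∈ 𝓝[L] (D.m 0) := inter_mem (mem_nhdsWithin_of_mem_nhds (hW.mem_nhds hm0W)) hnhds
    exact mem_of_superset h1 hWdisc
  have hι₃ : MapsTo (subsetInclusion hFL) ({pF}ᶜ : Set ↥Fδ) ({pL}ᶜ : Set ↥L) := by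
    intro y hy h
    apply hy
    rw [mem_singleton_iff] at h ⊢
    exact Subtype.ext (congrArg Subtype.val h :)
  haveI iso₃ : IsIso (relativeSingularHomology.map R M (subsetInclusion hFL) hι₃ n) :=
    localHomology.isIso_map_subsetInclusion_of_mem_nhdsWithin_coeff R M hFL hm0F hFnhds n hι₃
  -- (4) the composite `B(0, δ) → ℝᵏ ∪ {∞}` is the open embedding `β`
  set ω : C(↥Bδ, OnePoint (EuclideanSpace ℝ (Fin k))) :=
    (g.comp (subsetIncl L)).comp ((subsetInclusion hFL).comp ((e : C(↥Cδ, ↥Fδ)).comp (subsetInclusion hBC)))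
    with hω
  have hωeq : (ω : ↥Bδ → OnePoint (EuclideanSpace ℝ (Fin k))) =
      ballCollapseFun ∘ ((↑) : ↥(ball (0 : EuclideanSpace ℝ (Fin k)) 1) → _) ∘
        Set.inclusion (ball_subset_ball hδ1) := by
    funext v
    have hvC : (v : EuclideanSpace ℝ (Fin k)) ∈ Cδ := hBC v.2
    have hvr : (v : EuclideanSpace ℝ (Fin k)) ∈ closedBall 0 D.r := hCr hvC
    have h1 : (ω v : OnePoint (EuclideanSpace ℝ (Fin k))) = g (D.m v) := by
      simp only [hω, ContinuousMap.comp_apply]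
      change g ((e (subsetInclusion hBC v) : X)) = g (D.m v)
      rw [he]
      rfl
    rw [h1]
    have h2 := hgV ⟨D.m v, hmN hvr⟩ (hδV v hvC)
    rw [hKm v hvr] at h2
    exact h2
  have hωemb : IsOpenEmbedding ω := by
    rw [hωeq]
    exact isOpenEmbedding_ballCollapseFun_comp_subtypeVal.comp
      (IsOpenEmbedding.inclusion (ball_subset_ball hδ1)
        (isOpen_ball.preimage continuous_subtype_val))
  have hω0 : ω b0 = ↑(0 : EuclideanSpace ℝ (Fin k)) := by
    have := congrFun hωeq b0
    rw [this]
    exact ballCollapseFun_eq_coe_zero_iff.2 rfl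
  haveI isoω := localHomology.isIso_map_of_isOpenEmbedding_of_eq R M ω hωemb b0 hω0 n
  -- factorisation and conclusion
  have hfac : relativeSingularHomology.map R M ω
        (mapsTo_compl_singleton_of_injective hωemb.injective hω0) n =
      (relativeSingularHomology.map R M (subsetInclusion hBC) hι₁ n ≫
        relativeSingularHomology.map R M (e : C(↥Cδ, ↥Fδ)) hι₂ n ≫
        relativeSingularHomology.map R M (subsetInclusion hFL) hι₃ n) ≫
      relativeSingularHomology.map R M (g.comp (subsetIncl L)) (mapsTo_compl_of_apply_eq_iff hgP hLP) n := by
    rw [← relativeSingularHomology.map_comp, ← relativeSingularHomology.map_comp,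
      ← relativeSingularHomology.map_comp]
    rfl
  haveI : IsIso (relativeSingularHomology.map R M (subsetInclusion hBC) hι₁ n ≫
      relativeSingularHomology.map R M (e : C(↥Cδ, ↥Fδ)) hι₂ n ≫
      relativeSingularHomology.map R M (subsetInclusion hFL) hι₃ n) := IsIso.comp_isIso
  exact IsIso.of_isIso_fac_left hfac.symm

end TransverseDiscDatum

end Literature.AlgebraicTopology.SingularHomology

end
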